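import Mathlib
import Summits.Ventures.PercRepro2.HCov
import Summits.Ventures.PercRepro2.RootLeafUHalf
import Summits.Ventures.PercRepro2.RootLeafUTheorem
import Summits.Ventures.PercRepro2.RootLeafUMixK
import Summits.Ventures.PercRepro2.RootLeafUMixKA
import Summits.Ventures.PercRepro2.RootLeafUMixL
import Summits.Ventures.PercRepro2.RootLeafUMixLA

/-!
# (G4-u): THE CLASS THEOREM — `0 ≤ T2`, hence (HCOV) for a root pendant at an unmarked `u`, on the
explicit class «(2β − A)·ℋ′ ≤ ℰ·(e0P₀ − d0P_o) ∧ (2β + B)·δ_o ≤ (OU)·Y»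
(blind cell PercRepro2, p4 g13; S3 item (aa); no definitions)

From the two mirror identities (RootLeafUMixK / RootLeafUMixL) and the two ρ = 1 BHK steps
(RootLeafUMixKA `HoK_add_Xb_nonneg`, RootLeafUMixLA `cov_bnotL_le`):

  `P₀·T2oK ≥ (A − 2β)·ℋ′ + ℰ·(e0P₀ − d0P_o)`,   `W·T2oL ≥ (|B| − 2β)·δ_o + (OU)·Y`.

* **`MixK.T2oK_nonneg_of_classK`**: `(2β − A)·ℋ′ ≤ ℰ·(e0P₀ − d0P_o) → 0 ≤ T2oK` (contains `2β ≤ A`);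
* **`T2_nonneg_of_classes`** and **`HCov_root_leaf_u_of_classes`**: on the class where both criteria hold,
  `0 ≤ T2` and (G4-u) — (HCOV) at `(o, a₁, a₂, c, b)` for `a₁` pendant at `u` — follow from (HCOV) at the
  smaller instance `(o, u, a₂, c, b)` (`HCov_root_leaf_u_of`).

Census (own code, classes.py; 900 random instances n ≤ 7, three palettes): the `K` criterion holds on
84–89 %, the `L` criterion on 82–86 %, BOTH on 80–82 % — the (G4-u) induction step is a THEOREM on
≈ 80 % of random instances, by an explicit computable criterion in the masses of the smaller instance.
-/

namespace Summit.Ventures.PercRepro2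

open UnionCluster CovForm

namespace RootLeafU

namespace MixK

variable {V : Type*} {E : Type*} [Fintype E] [DecidableEq E] [Fintype V] [DecidableEq V]
  {R : Type*} [Field R] [LinearOrder R] [IsStrictOrderedRing R]

section Classes

variable (p : E → R) (ends : E → Sym2 V) (o a₂ c b u : V)

/-- **The `o ∈ K` half on the class `(2β − A)·ℋ′ ≤ ℰ·(e0P₀ − d0P_o)`**: `0 ≤ T2oK` (contains the class
`2β ≤ A` of `T2oK_nonneg_of_two_beta_le`). -/
theorem T2oK_nonneg_of_classK (hp : IsProbVec p)
    (hcls : (2 * (prob p Set.univ * prob p (PDEvent ends u a₂ c) +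
          prob p (avoidAll ends a₂ {c}) * prob p (avoidAll ends a₂ {u})) -
        ((prob p (PDEvent ends u a₂ c) * prob p (connEvent ends a₂ b) +
            prob p (avoidAll ends a₂ {c}) * gap p ends u a₂ b) +
          (prob p Set.univ * EQb3 p ends u a₂ c b + prob p Set.univ * PDb p ends u a₂ c b +
            prob p (connEvent ends a₂ b) * EQ3 p ends u a₂ c +
            prob p (connEvent ends a₂ b) * prob p (avoidAll ends a₂ {u}) -
            (prob p Set.univ - prob p (avoidAll ends a₂ {c})) * gap p ends u a₂ b))) *
        (prob p (TEvent ends a₂ u c) * prob p (PDEvent ends u a₂ c ∩ connEvent ends a₂ o) -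
          prob p (PDEvent ends u a₂ c) * prob p (TEvent ends a₂ u c ∩ connEvent ends a₂ o)) ≤
      Ee p ends a₂ c b u *
        (prob p (avoidAll ends a₂ {c} ∩ connEvent ends a₂ o) *
            (prob p (PDEvent ends u a₂ c) + prob p (TEvent ends a₂ u c)) -
          prob p (avoidAll ends a₂ {c}) *
            (prob p (PDEvent ends u a₂ c ∩ connEvent ends a₂ o) +
              prob p (TEvent ends a₂ u c ∩ connEvent ends a₂ o)))) :
    0 ≤ T2oK p ends o a₂ c b u := by
  have hid := P0_mul_T2oK_eq p ends o a₂ c b u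
  have hHX := HoK_add_Xb_nonneg p ends o a₂ c b u hp
  have hβ : 0 ≤ prob p Set.univ * prob p (PDEvent ends u a₂ c) +
      prob p (avoidAll ends a₂ {c}) * prob p (avoidAll ends a₂ {u}) :=
    add_nonneg (mul_nonneg (prob_nonneg hp _) (prob_nonneg hp _))
      (mul_nonneg (prob_nonneg hp _) (prob_nonneg hp _))
  have hP0 : 0 ≤ prob p (PDEvent ends u a₂ c) + prob p (TEvent ends a₂ u c) :=
    add_nonneg (prob_nonneg hp _) (prob_nonneg hp _)
  rcases hP0.lt_or_eq with hpos | hzero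
  · have h : 0 ≤ (prob p (PDEvent ends u a₂ c) + prob p (TEvent ends a₂ u c)) * T2oK p ends o a₂ c b u := by
      rw [hid]
      nlinarith [mul_nonneg hβ hHX]
    rcases lt_or_ge (T2oK p ends o a₂ c b u) 0 with hneg | hge
    · have := mul_neg_of_pos_of_neg hpos hneg
      linarith
    · exact hge
  · have hz := hzero.symm
    have hE := Ee_nonneg p ends a₂ c b u hp
    have he0 := prob_nonneg hp (avoidAll ends a₂ {c} ∩ connEvent ends a₂ o)
    unfold T2oK
    have h1 := prob_PD_eq_zero_of_P0 p ends a₂ c u hp hz (connEvent ends a₂ o)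
    have h2 := prob_PD_eq_zero_of_P0 p ends a₂ c u hp hz (connEvent ends a₂ o ∩ connEvent ends a₂ b)
    have h3 := prob_PD_eq_zero_of_P0 p ends a₂ c u hp hz (connEvent ends a₂ o ∩ connEvent ends u b)
    rw [h1.1, h1.2, h2.2, h3.1, h3.2]
    have := mul_nonneg hE he0
    linarith

end Classes

end MixK

section Theorem

variable {V : Type*} {E : Type*} [Fintype E] [DecidableEq E] [Fintype V] [DecidableEq V]
  {R : Type*} [Field R] [LinearOrder R] [IsStrictOrderedRing R]
variable (p : E → R) (ends : E → Sym2 V) (o a₂ c b u : V)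

/-- **`0 ≤ T2` on the class where both criteria hold.** -/
theorem T2_nonneg_of_classes (hp : IsProbVec p)
    (hK : (2 * (prob p Set.univ * prob p (PDEvent ends u a₂ c) +
          prob p (avoidAll ends a₂ {c}) * prob p (avoidAll ends a₂ {u})) -
        ((prob p (PDEvent ends u a₂ c) * prob p (connEvent ends a₂ b) +
            prob p (avoidAll ends a₂ {c}) * gap p ends u a₂ b) +
          (prob p Set.univ * EQb3 p ends u a₂ c b + prob p Set.univ * PDb p ends u a₂ c b +
            prob p (connEvent ends a₂ b) * EQ3 p ends u a₂ c +
            prob p (connEvent ends a₂ b) * prob p (avoidAll ends a₂ {u}) -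
            (prob p Set.univ - prob p (avoidAll ends a₂ {c})) * gap p ends u a₂ b))) *
        (prob p (TEvent ends a₂ u c) * prob p (PDEvent ends u a₂ c ∩ connEvent ends a₂ o) -
          prob p (PDEvent ends u a₂ c) * prob p (TEvent ends a₂ u c ∩ connEvent ends a₂ o)) ≤
      Ee p ends a₂ c b u *
        (prob p (avoidAll ends a₂ {c} ∩ connEvent ends a₂ o) *
            (prob p (PDEvent ends u a₂ c) + prob p (TEvent ends a₂ u c)) -
          prob p (avoidAll ends a₂ {c}) *
            (prob p (PDEvent ends u a₂ c ∩ connEvent ends a₂ o) +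
              prob p (TEvent ends a₂ u c ∩ connEvent ends a₂ o))))
    (hL : (2 * (prob p Set.univ * prob p (PDEvent ends u a₂ c) +
          prob p (avoidAll ends a₂ {c}) * prob p (avoidAll ends a₂ {u})) +
        ((prob p (PDEvent ends u a₂ c) * prob p (connEvent ends a₂ b) +
            prob p (avoidAll ends a₂ {c}) * gap p ends u a₂ b) -
          (prob p Set.univ * EQb3 p ends u a₂ c b + prob p Set.univ * PDb p ends u a₂ c b +
            prob p (connEvent ends a₂ b) * EQ3 p ends u a₂ c +
            prob p (connEvent ends a₂ b) * prob p (avoidAll ends a₂ {u}) -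
            (prob p Set.univ - prob p (avoidAll ends a₂ {c})) * gap p ends u a₂ b))) *
        (prob p (TEvent ends u a₂ c) * prob p (PDEvent ends u a₂ c ∩ connEvent ends u o) -
          prob p (PDEvent ends u a₂ c) * prob p (TEvent ends u a₂ c ∩ connEvent ends u o)) ≤
      T2oL p ends u a₂ c b u *
        (prob p (PDEvent ends u a₂ c ∩ connEvent ends u o) +
          prob p (TEvent ends u a₂ c ∩ connEvent ends u o))) :
    0 ≤ T2 p ends o a₂ c b u :=
  T2_nonneg_of_halves p ends o a₂ c b u (MixL.T2oL_nonneg_of_classL p ends o a₂ c b u hp hL)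
    (MixK.T2oK_nonneg_of_classK p ends o a₂ c b u hp hK)

/-- **(G4-u) on the class**: (HCOV) for a root `a₁` pendant at the unmarked `u` follows from (HCOV) at
the smaller instance `(o, u, a₂, c, b)` whenever both class criteria hold there. -/
theorem HCov_root_leaf_u_of_classes (hp : IsProbVec p) {f : E} {a₁ : V} (hf : ends f = s(a₁, u))
    (hleaf : ∀ e, a₁ ∈ ends e → e = f) (h1u : a₁ ≠ u) (h12 : a₁ ≠ a₂) (h1c : a₁ ≠ c)
    (h1o : a₁ ≠ o) (h1b : a₁ ≠ b)
    (hK : (2 * (prob p Set.univ * prob p (PDEvent ends u a₂ c) +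
          prob p (avoidAll ends a₂ {c}) * prob p (avoidAll ends a₂ {u})) -
        ((prob p (PDEvent ends u a₂ c) * prob p (connEvent ends a₂ b) +
            prob p (avoidAll ends a₂ {c}) * gap p ends u a₂ b) +
          (prob p Set.univ * EQb3 p ends u a₂ c b + prob p Set.univ * PDb p ends u a₂ c b +
            prob p (connEvent ends a₂ b) * EQ3 p ends u a₂ c +
            prob p (connEvent ends a₂ b) * prob p (avoidAll ends a₂ {u}) -
            (prob p Set.univ - prob p (avoidAll ends a₂ {c})) * gap p ends u a₂ b))) *
        (prob p (TEvent ends a₂ u c) * prob p (PDEvent ends u a₂ c ∩ connEvent ends a₂ o) -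
          prob p (PDEvent ends u a₂ c) * prob p (TEvent ends a₂ u c ∩ connEvent ends a₂ o)) ≤
      Ee p ends a₂ c b u *
        (prob p (avoidAll ends a₂ {c} ∩ connEvent ends a₂ o) *
            (prob p (PDEvent ends u a₂ c) + prob p (TEvent ends a₂ u c)) -
          prob p (avoidAll ends a₂ {c}) *
            (prob p (PDEvent ends u a₂ c ∩ connEvent ends a₂ o) +
              prob p (TEvent ends a₂ u c ∩ connEvent ends a₂ o))))
    (hL : (2 * (prob p Set.univ * prob p (PDEvent ends u a₂ c) +
          prob p (avoidAll ends a₂ {c}) * prob p (avoidAll ends a₂ {u})) +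
        ((prob p (PDEvent ends u a₂ c) * prob p (connEvent ends a₂ b) +
            prob p (avoidAll ends a₂ {c}) * gap p ends u a₂ b) -
          (prob p Set.univ * EQb3 p ends u a₂ c b + prob p Set.univ * PDb p ends u a₂ c b +
            prob p (connEvent ends a₂ b) * EQ3 p ends u a₂ c +
            prob p (connEvent ends a₂ b) * prob p (avoidAll ends a₂ {u}) -
            (prob p Set.univ - prob p (avoidAll ends a₂ {c})) * gap p ends u a₂ b))) *
        (prob p (TEvent ends u a₂ c) * prob p (PDEvent ends u a₂ c ∩ connEvent ends u o) -
          prob p (PDEvent ends u a₂ c) * prob p (TEvent ends u a₂ c ∩ connEvent ends u o)) ≤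
      T2oL p ends u a₂ c b u *
        (prob p (PDEvent ends u a₂ c ∩ connEvent ends u o) +
          prob p (TEvent ends u a₂ c ∩ connEvent ends u o)))
    (h3 : HCov p ends o u a₂ c b) : HCov p ends o a₁ a₂ c b :=
  HCov_root_leaf_u_of p ends hp hf hleaf h1u h12 h1c h1o h1b
    (T2_nonneg_of_classes p ends o a₂ c b u hp hK hL) h3

end Theorem

end RootLeafU

end Summit.Ventures.PercRepro2
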